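import Summits.HubbardSuperconductivity.HubbardSuperconductivity.Theorems.WeakCouplingBCSWcbcsTowerTrialBudget
import Summits.HubbardSuperconductivity.HubbardSuperconductivity.Theorems.AposterioriCapRgSsbToEvenTorusLroFacePurityOfRepelledOrder
import Summits.HubbardSuperconductivity.HubbardSuperconductivity.Theorems.AposterioriCapRgSsbToEvenTorusLroGlue
import HarnessLib

/-!
# Route `AposterioriCapRg` — crux `SsbToEvenTorusLro` (stmt-HubbardSuperconductivity-1315),
# line `pair-yrast-landau-floor`: the CONVERSE direction along even sides (Koma–Tasaki: LRO forces a linear source gain)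

The crux transfers Koma–Tasaki `d`-wave order (`HasDWaveOrder U μ`: a LINEAR gain of the sourced grand-canonical
ground energy, `E₀(K_μ) − E₀(K_μ − h(Δ+Δᴴ)) ≳ 2hmL²`, `L → ∞` then `h ↓ 0`, along ALL sides) to `d`-wave pair-field
LRO of every sector ground state on EVEN tori. This file records the converse bookkeeping the tree already supports
(Koma–Tasaki 1994, Theorem 2.2 'lite' = the landed abstract tower trial-state budget `WcbcsTowerTrial.trial_budget`):

* `kt_sourceGain_of_groundState_pairFloor` — finite `L`: ONE normalised `(N, S^z=0)`-sector ground state `ψ` of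
  `hubbardTorus 2 L 1 U` (`U ≥ 0`) with pair floor `q₀ ≤ Re⟨ψ, Δ_dᴴΔ_d ψ⟩` forces
  `h√q₀ − B(2+U)L²/(4q₀) − |μ| ≤ (E_sec(N) − μN) − E₀(K_μ − h(Δ_d+Δ_dᴴ))` for every `μ` and `h ≥ 0`
  (trial vector `ψ + Oψ/‖Oψ‖`; `B = B_d` the graded-locality constant of the double commutator).
* `kt_evenSourceGain_of_uniformPairFloor_of_densityMatched` — with grand-canonical density matching at `μ` (the landed
  `T = 0` equivalence of ensembles absorbs `E_sec(N_L) − μN_L − E₀(K_μ)`): a uniform pair floor `aL⁴` on the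
  even-side sector ground states gives, for every `h > 0` and `ε > 0`, eventually along even sides,
  `(h√a − ε)·L² ≤ E₀(K_μ) − E₀(K_μ − h(Δ_d+Δ_dᴴ))` — a LINEAR source gain, i.e. the even-sided Koma–Tasaki order
  parameter is `≥ √a/2` (the tree's `dWaveOrderParameter` takes its `liminf` over ALL sides, so odd tori keep this
  from being `HasDWaveOrder U μ` itself — cf. the disprovers' `dWaveOrderParameter_le_even`).
* `kt_evenSourceGain_of_hasDWavePairFieldLROAt` — the crux's CONCLUSION at `(U, δ)` (the summit matrix) plus density
  matching at `μ` forces that linear even-sided source gain at `(U, μ)`;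
  `SsbToEvenTorusLro_imp_evenSourceGain` — packaged on the crux BY NAME.

So, modulo the parity of the sides, the crux's order hypothesis and its conclusion force each other's ENERGY forms:
the transfer is an `iff` in spirit, and its entire content is the every-ground-state / infrared dissection of the
line's skeleton. Folklore bookkeeping over the finite-dimensional variational principle (Koma–Tasaki 1994 Thm 2.2;
Kaplan–Horsch–von der Linden 1989). No definition is introduced.
-/

noncomputable section

namespace Summit.HubbardSuperconductivity.HubbardSuperconductivity.Theorems

set_option linter.dupNamespace false

open Literature.MathematicalPhysics.QuantumLattice Literature.Probability.LatticeModels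
open Literature.Barriers.HubbardSuperconductivity
open Filter Set Matrix
open scoped Matrix ComplexOrder Matrix.Norms.L2Operator
open _root_.Topology
open Summit.HubbardSuperconductivity.WcbcsSsbToTorusLRO.Negative
  (exists_unit_groundStateInSector halfFilling_floor_le_sq floor_of_hasDWavePairFieldLROAt)
open Summit.HubbardSuperconductivity.HubbardSuperconductivity.Theorems.CwSsbToEvenTorusLRO
  (stub_canonicalSupportingPotential)
open Summit.HubbardSuperconductivity.HubbardSuperconductivity.Theses.AposterioriCapRg (SsbToEvenTorusLro)

/-! ## Finite `L`: one LRO sector ground state forces a source gain (Koma–Tasaki Thm 2.2 'lite') -/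

/-- **Finite-`L` Koma–Tasaki source gain from ONE sector ground state with a pair floor.** There is `B ≥ 0` (the
graded-locality constant of `‖[O,[O,H_U]]‖ ≤ B(2+U)L²`, `O = Δ_d + Δ_dᴴ`) such that for every `L ≥ 1`, `U ≥ 0`,
`μ`, `h ≥ 0`, `N` and every normalised `(N, S^z = 0)`-sector ground state `ψ` of `hubbardTorus 2 L 1 U` with
`0 < q₀ ≤ Re⟨ψ, Δ_dᴴ Δ_d ψ⟩`:
`h·√q₀ − B(2+U)L²/(4q₀) − |μ| ≤ (E_sec(N) − μN) − E₀(K_μ − h(Δ_d + Δ_dᴴ))`.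
Proof: the abstract budget `WcbcsTowerTrial.trial_budget` with `H₀ = H = H_U`, the charge rule `[N̂, Δ_d] = −2Δ_d`,
`‖Oψ‖² = ‖Δ_dψ‖² + ‖Δ_dᴴψ‖² ≥ q₀`, and the variational principle for `dWaveSourceTorus L U μ h = H − μN̂ − hO`.
[cite: KomaTasaki1994, Theorem 2.2] -/
theorem kt_sourceGain_of_groundState_pairFloor :
    ∃ B : ℝ, 0 ≤ B ∧ ∀ (L : ℕ) [NeZero L] (U μ h : ℝ), 0 ≤ U → 0 ≤ h → ∀ (N : ℕ) (ψ : Fock (Orb (FermionTorus 2 L))),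
      IsGroundStateInSector (hubbardTorus 2 L 1 U) N 0 ψ → star ψ ⬝ᵥ ψ = 1 → ∀ q₀ : ℝ, 0 < q₀ →
        q₀ ≤ (expect ((pairField dWaveFormFactor L)ᴴ * pairField dWaveFormFactor L) ψ).re →
          h * Real.sqrt q₀ - B * (2 + U) * (L : ℝ) ^ 2 / (4 * q₀) - |μ| ≤
            ((hubbardTorus 2 L 1 U).minEnergyOn (szSector N 0) - μ * (N : ℝ)) -
              (dWaveSourceTorus L U μ h).groundEnergy := by
  set S : Finset (Site 2) := insert 0 unitSteps with hS_def
  set B : ℝ := 144 * (S.card : ℝ) ^ 2 * (S.card + 2) *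
    (2 * ∑ e ∈ S, |dWaveFormFactor e / Real.sqrt 2|) ^ 2 with hB_def
  have hB0 : 0 ≤ B := by positivity
  refine ⟨B, hB0, ?_⟩
  intro L _ U μ h hU hh N ψ hψ hψ1 q₀ hq₀ hfl
  obtain ⟨hmem, hne, heig⟩ := hψ
  set X := pairField dWaveFormFactor L with hX_def
  set H := hubbardTorus 2 L 1 U with hH_def
  have hH : H.IsHermitian := LiebThm1.hamiltonian_isHermitian (fermionTorusGraph 2 L) 1 U
  have hNh : (totalNumber : Matrix (Finset (Orb (FermionTorus 2 L))) _ ℂ).IsHermitian :=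
    totalNumber_isHermitian
  have hXc : totalNumber * X - X * totalNumber = ((-2 : ℝ) : ℂ) • X :=
    WcbcsTowerTrial.totalNumber_commutator_pairField dWaveFormFactor L
  have hNψ := WcbcsTrialState.totalNumber_mulVec_of_isNParticle ((mem_szSector_iff _ _ _).1 hmem).1
  -- the sourced ground energy is a lower bound of `H − μN̂ − hO` on unit vectors
  have hsrc : (dWaveSourceTorus L U μ h).IsHermitian :=
    dWaveSourceTorus_isHermitian L (isHermitian_hubbardTorusWith L 1 U μ) h
  have hE : ∀ φ : Fock (Orb (FermionTorus 2 L)), star φ ⬝ᵥ φ = 1 →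
      (dWaveSourceTorus L U μ h).groundEnergy ≤
        (star φ ⬝ᵥ ((H - (μ : ℂ) • totalNumber - (h : ℂ) • (X + Xᴴ)) *ᵥ φ)).re := by
    intro φ hφ
    have h1 := groundEnergy_le_rayleigh_holds hsrc φ hφ
    rw [dWaveSourceTorus_eq, hubbardTorusWith_eq] at h1
    exact h1
  -- `‖Oψ‖² = ‖Xψ‖² + ‖Xᴴψ‖² ≥ q₀ > 0`
  obtain ⟨hqsplit, -⟩ := WcbcsTowerTrial.charged_number_expect hNh hXc hNψ
  have hXX : star (X *ᵥ ψ) ⬝ᵥ (X *ᵥ ψ) = expect (Xᴴ * X) ψ := by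
    rw [Literature.MathematicalPhysics.QuantumLattice.star_mulVec_dotProduct_mulVec]; rfl
  have hq_ge : q₀ ≤ (star ((X + Xᴴ) *ᵥ ψ) ⬝ᵥ ((X + Xᴴ) *ᵥ ψ)).re := by
    rw [hqsplit, Complex.add_re, hXX]
    have h2 : 0 ≤ (star (Xᴴ *ᵥ ψ) ⬝ᵥ (Xᴴ *ᵥ ψ)).re :=
      (Complex.nonneg_iff.mp (dotProduct_star_self_nonneg _)).1
    linarith
  have hq : 0 < (star ((X + Xᴴ) *ᵥ ψ) ⬝ᵥ ((X + Xᴴ) *ᵥ ψ)).re := lt_of_lt_of_le hq₀ hq_ge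
  -- the abstract budget with `H₀ = H`
  have key := WcbcsTowerTrial.trial_budget hH hNh hXc (fun v => le_rfl) hψ1 heig hNψ hE hq
  -- the double commutator
  have hD := WcbcsTowerTrial.norm_doubleCommutator_hubbardTorus_le dWaveFormFactor L hU
  set q : ℝ := (star ((X + Xᴴ) *ᵥ ψ) ⬝ᵥ ((X + Xᴴ) *ᵥ ψ)).re with hq_def
  -- monotonicity in `q ≥ q₀` of the two `q`-dependent terms
  have hsqrt : h * Real.sqrt q₀ ≤ h * Real.sqrt q :=
    mul_le_mul_of_nonneg_left (Real.sqrt_le_sqrt hq_ge) hh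
  have hL2 : (0 : ℝ) ≤ (L : ℝ) ^ 2 := by positivity
  have hnum : 0 ≤ B * (2 + U) * (L : ℝ) ^ 2 := by
    have : 0 ≤ 2 + U := by linarith
    positivity
  have hfrac : ‖(X + Xᴴ) * ((X + Xᴴ) * H - H * (X + Xᴴ)) - ((X + Xᴴ) * H - H * (X + Xᴴ)) * (X + Xᴴ)‖ /
      (4 * q) ≤ B * (2 + U) * (L : ℝ) ^ 2 / (4 * q₀) := by
    calc ‖(X + Xᴴ) * ((X + Xᴴ) * H - H * (X + Xᴴ)) - ((X + Xᴴ) * H - H * (X + Xᴴ)) * (X + Xᴴ)‖ / (4 * q)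
        ≤ B * (2 + U) * (L : ℝ) ^ 2 / (4 * q) :=
          div_le_div_of_nonneg_right hD (by positivity)
      _ ≤ B * (2 + U) * (L : ℝ) ^ 2 / (4 * q₀) := by
          apply div_le_div_of_nonneg_left hnum (by positivity)
          linarith
  linarith [key, hsqrt, hfrac]

/-! ## Even sides, density matched: a uniform pair floor forces a LINEAR source gain -/

/-- **Even-sided Koma–Tasaki bound from a uniform pair floor (density matched).** For `U ≥ 0`, `δ ∈ (0,1)`,
grand-canonical density matching at `μ`, and a uniform pair floor `aL⁴ ≤ Re⟨ψ, Δ_dᴴΔ_d ψ⟩` over the normalised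
`(N_L, S^z=0)`-sector ground states eventually along even sides: for every `h > 0` and `ε > 0`, eventually along even
sides `L = 2k+2`, `(h√a − ε)·L² ≤ E₀(K_μ) − E₀(K_μ − h(Δ_d + Δ_dᴴ))`. (Finite-`L` gain + the landed `T = 0` equivalence
of ensembles `fp_canonicalGCEquivalence_of_csp_of_densityMatched`; the `O(1/L²)` double-commutator term and `|μ|` are
absorbed by `ε`.) [cite: KomaTasaki1994, Theorem 2.2] -/
theorem kt_evenSourceGain_of_uniformPairFloor_of_densityMatched {U δ μ : ℝ} (hU : 0 ≤ U) (hδ : δ ∈ Set.Ioo (0:ℝ) 1)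
    (hdm : Filter.Tendsto (fun L : ℕ => ((hubbardTorusWith 2 (L + 1) 1 U μ).groundStateFunctional totalNumber).re / ((L + 1 : ℕ) : ℝ) ^ 2) Filter.atTop (nhds (1 - δ)))
    (hfloor : ∃ a : ℝ, 0 < a ∧ ∀ᶠ k : ℕ in Filter.atTop, ∀ ψ : Fock (Orb (FermionTorus 2 (2 * k + 1 + 1))),
      IsGroundStateInSector (hubbardTorus 2 (2 * k + 1 + 1) 1 U) (2 * ⌊(1 - δ) * (((2 * k + 1 + 1) : ℕ) : ℝ) ^ 2 / 2⌋₊) 0 ψ → star ψ ⬝ᵥ ψ = 1 →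
        a * ((2 * k + 1 + 1 : ℕ) : ℝ) ^ 4 ≤ (expect ((pairField dWaveFormFactor (2 * k + 1 + 1))ᴴ * pairField dWaveFormFactor (2 * k + 1 + 1)) ψ).re) :
    ∃ a : ℝ, 0 < a ∧ ∀ h : ℝ, 0 < h → ∀ ε : ℝ, 0 < ε → ∀ᶠ k : ℕ in Filter.atTop,
      (h * Real.sqrt a - ε) * ((2 * k + 1 + 1 : ℕ) : ℝ) ^ 2 ≤
        (hubbardTorusWith 2 (2 * k + 1 + 1) 1 U μ).groundEnergy -
          (dWaveSourceTorus (2 * k + 1 + 1) U μ h).groundEnergy := by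
  obtain ⟨a, ha, hfloor⟩ := hfloor
  obtain ⟨B, hB, hfin⟩ := kt_sourceGain_of_groundState_pairFloor
  have hδ1 : δ ≤ 1 := hδ.2.le
  have hδ0 : 0 ≤ δ := hδ.1.le
  have hcge := fp_canonicalGCEquivalence_of_csp_of_densityMatched (U := U) (μ := μ) hδ1
    (stub_canonicalSupportingPotential U δ hδ) hdm
  refine ⟨a, ha, fun h hh ε hε => ?_⟩
  obtain ⟨L₁, hL₁⟩ := hcge (ε / 2) (by positivity)
  -- the constant to absorb: `B(2+U)/(4a) + |μ| ≤ (ε/2) L²` for large `L`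
  set C : ℝ := B * (2 + U) / (4 * a) + |μ| with hC_def
  have hC : 0 ≤ C := by
    have : 0 ≤ 2 + U := by linarith
    positivity
  obtain ⟨L₂, hL₂⟩ := exists_nat_ge (2 * C / ε)
  filter_upwards [hfloor, eventually_ge_atTop (max L₁ L₂)] with k hk hkL
  set L : ℕ := 2 * k + 1 + 1 with hL_def
  have hEven : Even L := ⟨k + 1, by rw [hL_def]; ring⟩
  have hL₁' : L₁ ≤ L := (le_max_left _ _).trans (hkL.trans (by omega))
  have hL₂' : (L₂ : ℝ) ≤ (L : ℝ) := by exact_mod_cast (le_max_right _ _).trans (hkL.trans (by omega))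
  have hLr1 : (1 : ℝ) ≤ (L : ℝ) := by exact_mod_cast (show 1 ≤ L by omega)
  have hLpos : (0 : ℝ) < (L : ℝ) := by linarith
  have hL2pos : (0 : ℝ) < (L : ℝ) ^ 2 := by positivity
  -- a normalised sector ground state and its pair floor
  haveI : NeZero L := ⟨by omega⟩
  obtain ⟨ψ, hψ1, hψ⟩ := exists_unit_groundStateInSector L U (halfFilling_floor_le_sq L hδ0)
  have hfl := hk ψ hψ hψ1
  have hq₀ : 0 < a * (L : ℝ) ^ 4 := by positivity
  have hgain := hfin L U μ h hU hh.le _ ψ hψ hψ1 (a * (L : ℝ) ^ 4) hq₀ hfl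
  have hcgek := hL₁ L hL₁' hEven
  -- bookkeeping
  have hsqrt : Real.sqrt (a * (L : ℝ) ^ 4) = Real.sqrt a * (L : ℝ) ^ 2 := by
    rw [Real.sqrt_mul ha.le, show ((L : ℝ) ^ 4) = ((L : ℝ) ^ 2) ^ 2 by ring, Real.sqrt_sq hL2pos.le]
  rw [hsqrt] at hgain
  have hfrac : B * (2 + U) * (L : ℝ) ^ 2 / (4 * (a * (L : ℝ) ^ 4)) ≤ B * (2 + U) / (4 * a) := by
    rw [div_le_div_iff₀ (by positivity) (by positivity)]
    have h2U : 0 ≤ 2 + U := by linarith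
    have hL4 : (L : ℝ) ^ 2 ≤ (L : ℝ) ^ 4 := by
      have h1 : (1 : ℝ) ≤ (L : ℝ) ^ 2 := by nlinarith
      calc (L : ℝ) ^ 2 = (L : ℝ) ^ 2 * 1 := by ring
        _ ≤ (L : ℝ) ^ 2 * (L : ℝ) ^ 2 := mul_le_mul_of_nonneg_left h1 hL2pos.le
        _ = (L : ℝ) ^ 4 := by ring
    have := mul_le_mul_of_nonneg_left hL4 (show 0 ≤ B * (2 + U) * (4 * a) by positivity)
    nlinarith [this]
  have hCL : C ≤ ε / 2 * (L : ℝ) ^ 2 := by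
    have h1 : 2 * C / ε ≤ (L : ℝ) := hL₂.trans hL₂'
    rw [div_le_iff₀ hε] at h1
    nlinarith [hC, hLr1]
  have e1 : (h * Real.sqrt a - ε) * (L : ℝ) ^ 2 = h * (Real.sqrt a * (L : ℝ) ^ 2) - ε * (L : ℝ) ^ 2 := by ring
  rw [e1]
  linarith [hgain, hcgek, hfrac, hCL]

/-- **The summit matrix at `(U, δ)` forces a linear even-sided source gain at every density-matched `μ`** (`U ≥ 0`,
`δ ∈ (0,1)`): `HasDWavePairFieldLROAt U δ` gives the uniform pair floor (sibling's landed `floor_of_hasDWavePairFieldLROAt`),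
then `kt_evenSourceGain_of_uniformPairFloor_of_densityMatched`. [cite: KomaTasaki1994, Theorem 2.2] -/
theorem kt_evenSourceGain_of_hasDWavePairFieldLROAt {U δ μ : ℝ} (hU : 0 ≤ U) (hδ : δ ∈ Set.Ioo (0:ℝ) 1)
    (hdm : Filter.Tendsto (fun L : ℕ => ((hubbardTorusWith 2 (L + 1) 1 U μ).groundStateFunctional totalNumber).re / ((L + 1 : ℕ) : ℝ) ^ 2) Filter.atTop (nhds (1 - δ)))
    (hM : HasDWavePairFieldLROAt U δ) :
    ∃ a : ℝ, 0 < a ∧ ∀ h : ℝ, 0 < h → ∀ ε : ℝ, 0 < ε → ∀ᶠ k : ℕ in Filter.atTop,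
      (h * Real.sqrt a - ε) * ((2 * k + 1 + 1 : ℕ) : ℝ) ^ 2 ≤
        (hubbardTorusWith 2 (2 * k + 1 + 1) 1 U μ).groundEnergy -
          (dWaveSourceTorus (2 * k + 1 + 1) U μ h).groundEnergy :=
  kt_evenSourceGain_of_uniformPairFloor_of_densityMatched hU hδ hdm (floor_of_hasDWavePairFieldLROAt hδ.1.le hM)

/-- **The crux BY NAME forces the linear even-sided source gain at every ordered, density-matched point** (the
converse-direction bookkeeping: under the crux, `HasDWaveOrder U μ` + density matching at `(U, δ, μ)` ⇒ LRO of every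
even-side sector ground state ⇒ `E₀(K_μ) − E₀(K_μ − h(Δ_d+Δ_dᴴ)) ≥ (h√a − ε)L²` eventually along even sides).
[cite: KomaTasaki1994, Theorem 2.2] -/
theorem SsbToEvenTorusLro_imp_evenSourceGain :
    SsbToEvenTorusLro → ∀ (U δ μ : ℝ), 0 < U → δ ∈ Set.Ioo (0:ℝ) 1 → Filter.Tendsto (fun L : ℕ => ((hubbardTorusWith 2 (L + 1) 1 U μ).groundStateFunctional totalNumber).re / ((L + 1 : ℕ) : ℝ) ^ 2) Filter.atTop (nhds (1 - δ)) → HasDWaveOrder U μ → ∃ a : ℝ, 0 < a ∧ ∀ h : ℝ, 0 < h → ∀ ε : ℝ, 0 < ε → ∀ᶠ k : ℕ in Filter.atTop, (h * Real.sqrt a - ε) * ((2 * k + 1 + 1 : ℕ) : ℝ) ^ 2 ≤ (hubbardTorusWith 2 (2 * k + 1 + 1) 1 U μ).groundEnergy - (dWaveSourceTorus (2 * k + 1 + 1) U μ h).groundEnergy :=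
  fun hS U δ μ hU hδ hdm hO => kt_evenSourceGain_of_hasDWavePairFieldLROAt hU.le hδ hdm (hS U δ μ hU hδ hdm hO)

end Summit.HubbardSuperconductivity.HubbardSuperconductivity.Theorems

end
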